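import Summits.QuantumFields.YangMills.Theorems.BalabanLadderUVSeamRecClassicalResponseDefs
import Summits.QuantumFields.YangMills.Theorems.BalabanLadderUVSeamRecCeilingsSubGaussianCarrierUnit
import HarnessLib

/-!
# Crux `UVSeamRec` (stmt-QuantumFields-20043): the (β) press-button SPECIALISED to the classical carrier —
# (split with `carrierCl`) + (EM_lin for `√carrierCl`) + (PL) ⇒ the registered v5(α) stub body BY NAME

Helper file (`--supports stmt-QuantumFields-20043`) of the LEAD seat `ym-spine-20043-p1` (gen 8); sequel of p546887
`…ClassicalResponseDefs.lean` (the gauge-invariant classical response `carrierCl`) and p545723 `…CeilingsSubGaussianCarrierUnit.lean`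
(`responseMomentsOdd6_of_subGaussianLinear_and_polymerLaw`).  With the NAMED carrier the three open inputs of the (β) architecture of
`BirthV5A.stub_responseMomentsOdd6` become by-name statements a v6(β) could register as stubs:

* (split-cl)  `∀ β ≥ β₁ ∀ R ≥ 1, R·a β ≤ ℓ₁ → ∀ q x (q.1 < q.2) ∀ η, (R⁴/C₁)|kerE(plane q x)(η) − p q β| ≤ A₀ + carrierCl rF C s β R q x η + LF β R q x η`
  — «quantum response ≤ A₀ + β × classical response + large-field correction» (E0′-K with background);
* (EM_lin-cl) the extensive sub-Gaussian LINEAR-source law for `ℓ := √(carrierCl rF C s β R q x ·)` on every odd torus and separated family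
  (Gaussian/semiclassical domination of the classical centre response under the Wilson state; sub-Gaussian AROUND A MEAN, hence the `m·Σ|t_i|` term);
* (PL) the polymer product law for `LF` (p528131's typing, unchanged).

`responseMomentsOdd6_of_classicalSplit` : (split-cl) + (EM_lin-cl) + (PL) (+ `0 ≤ β₁`, `0 < C`, `0 < s`, `4v < 1`) ⇒ the registered stub's body.
HONEST FRAMING: composition only (`Q := 1·(√carrierCl)²`); the three laws are OPEN; nothing of E0′; not a gap, not Clay.
-/

set_option autoImplicit false

noncomputable section

open MeasureTheory Filter Topology Finset
open Literature.MathematicalPhysics.QuantumFieldTheory (GaugeConfig LatticeRep)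
open Literature.MathematicalPhysics.QuantumLattice
open Summit.QuantumFields.YangMills.Cruxes.OSLegsFromFemtoAndGap.DlrCollarTransfer
open Summit.QuantumFields.YangMills.Cruxes.UVSeamRec.ClassicalResponse

namespace Summit.QuantumFields.YangMills.Cruxes.UVSeamRec.TemperedResponse

section Unit

variable [MeasurableSpace (Matrix.specialUnitaryGroup (Fin 2) ℂ)] [BorelSpace (Matrix.specialUnitaryGroup (Fin 2) ℂ)]

/-- **The body of `stub_responseMomentsOdd6` from (split-cl) + (EM_lin-cl) + (PL)** — the (β) press-button with the NAMED gauge-invariant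
carrier `Q := carrierCl rF C s` (p546887) and its square root as the linear statistic of p545723's Hubbard–Stratonovich press-button
(`λ = 1`, `4v < 1`; `0 ≤ β₁` makes `Q ≥ 0` so that `(√Q)² = Q`). [folklore] -/
theorem responseMomentsOdd6_of_classicalSplit {a : ℝ → ℝ} {c C₁ β₁ ℓ₁ A₀ Λ W P₀ C s : ℝ}
    {p : Fin 4 × Fin 4 → ℝ → ℝ} (hc : 0 < c) (hle : ∀ᶠ β in atTop, a β ≤ c * Transport.uRec β) (hℓ₁ : 0 < ℓ₁)
    (hC₁ : 0 < C₁) (hp : ∀ q β, |p q β| ≤ P₀) (hC : 0 < C) (hs : 0 < s) (hβ₁ : 0 ≤ β₁)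
    (LF : ℝ → ℕ → Fin 4 × Fin 4 → (Fin 4 → ℤ) → LGConfig 4 (Matrix.specialUnitaryGroup (Fin 2) ℂ) → ℝ) (MLF : ℝ → ℕ → ℝ)
    (hLFm : ∀ β R q x, Measurable (LF β R q x)) (hLFb : ∀ β R q x η, |LF β R q x η| ≤ MLF β R)
    {m v : ℝ} (h4 : 4 * v < 1)
    (hsplit : ∀ β : ℝ, β₁ ≤ β → ∀ R : ℕ, 1 ≤ R → (R : ℝ) * a β ≤ ℓ₁ →
      ∀ (q : Fin 4 × Fin 4) (x : Fin 4 → ℤ), q.1 < q.2 → ∀ η : LGConfig 4 (Matrix.specialUnitaryGroup (Fin 2) ℂ),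
        (R : ℝ) ^ 4 / C₁ * |kerE (Matrix.specialUnitaryGroup (Fin 2) ℂ) (fundamentalLatticeRep 2) β (fun k => x k - (R + 1)) (2 * R + 3) η
          (plane (Matrix.specialUnitaryGroup (Fin 2) ℂ) (fundamentalLatticeRep 2) q x) - p q β| ≤
            A₀ + carrierCl (fundamentalLatticeRep 2) C s β R q x η + LF β R q x η)
    (hEMlin : ∀ β : ℝ, β₁ ≤ β → ∀ (L n : ℕ) (q : Fin n → Fin 4 × Fin 4) (x : Fin n → (Fin 4 → ℤ)) (R : ℕ),
      (∀ i, (q i).1 < (q i).2) → 1 ≤ R → (R : ℝ) * a β ≤ ℓ₁ → 4 * R + 8 ≤ L →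
      (∀ i j : Fin n, i ≠ j → ∃ k : Fin 4,
        (2 * (R : ℤ) + 4) ≤ |((((x i k - x j k : ℤ) : ZMod (2 * L + 1))).valMinAbs : ℤ)|) →
      ∀ (T : Finset (Fin n)) (t : Fin n → ℝ),
        torusE (Matrix.specialUnitaryGroup (Fin 2) ℂ) (fundamentalLatticeRep 2) β L
          (fun U => Real.exp (∑ i ∈ T, t i * Real.sqrt (carrierCl (fundamentalLatticeRep 2) C s β R (q i) (x i) U))) ≤
            Real.exp (m * ∑ i ∈ T, |t i| + v / 2 * ∑ i ∈ T, (t i) ^ 2))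
    (hPL : ∀ β : ℝ, β₁ ≤ β → ∀ (L n : ℕ) (q : Fin n → Fin 4 × Fin 4) (x : Fin n → (Fin 4 → ℤ)) (R : ℕ),
      (∀ i, (q i).1 < (q i).2) → 1 ≤ R → (R : ℝ) * a β ≤ ℓ₁ → 4 * R + 8 ≤ L →
      (∀ i j : Fin n, i ≠ j → ∃ k : Fin 4,
        (2 * (R : ℤ) + 4) ≤ |((((x i k - x j k : ℤ) : ZMod (2 * L + 1))).valMinAbs : ℤ)|) →
      ∃ (κ : Type) (S : Finset κ) (E : κ → Set (LGConfig 4 (Matrix.specialUnitaryGroup (Fin 2) ℂ))) (w : κ → ℝ) (cf : Fin n → κ → ℝ),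
        (∀ γ, MeasurableSet (E γ)) ∧ (∀ γ ∈ S, 0 ≤ w γ) ∧ (∀ i, ∀ γ ∈ S, 0 ≤ cf i γ) ∧
        (∀ (i : Fin n) (U : GaugeConfig 4 (2 * L + 1) (Matrix.specialUnitaryGroup (Fin 2) ℂ)),
          LF β R (q i) (x i) (torusLift (2 * L + 1) U) ≤
            ∑ γ ∈ S, cf i γ * (E γ).indicator (fun _ => (1 : ℝ)) (torusLift (2 * L + 1) U)) ∧
        (∀ γ ∈ S, ∑ i, cf i γ ≤ Λ) ∧ (∀ i, ∑ γ ∈ S, cf i γ * w γ ≤ W) ∧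
        (∀ A, A ⊆ S → torusE (Matrix.specialUnitaryGroup (Fin 2) ℂ) (fundamentalLatticeRep 2) β L
          (fun U => ∏ γ ∈ A, (E γ).indicator (fun _ => (1 : ℝ)) U) ≤ ∏ γ ∈ A, w γ)) :
    ∃ (a : ℝ → ℝ) (c : ℝ) (C₁ B β₁ ℓ₁ P₀ : ℝ) (p : Fin 4 × Fin 4 → ℝ → ℝ), 0 < c ∧
      (∀ᶠ β in atTop, a β ≤ c * Transport.uRec β) ∧ 0 < ℓ₁ ∧ 0 < C₁ ∧ (∀ q β, |p q β| ≤ P₀) ∧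
      ∀ β : ℝ, β₁ ≤ β → ∀ (L n : ℕ) (q : Fin n → Fin 4 × Fin 4) (x : Fin n → (Fin 4 → ℤ)) (R : ℕ),
        (∀ i, (q i).1 < (q i).2) → 1 ≤ R → (R : ℝ) * a β ≤ ℓ₁ → 4 * R + 8 ≤ L →
        (∀ i j : Fin n, i ≠ j → ∃ k : Fin 4,
          (2 * (R : ℤ) + 4) ≤ |((((x i k - x j k : ℤ) : ZMod (2 * L + 1))).valMinAbs : ℤ)|) →
        ∀ T : Finset (Fin n),
          torusE (Matrix.specialUnitaryGroup (Fin 2) ℂ) (fundamentalLatticeRep 2) β L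
            (fun U => Real.exp (∑ i ∈ T, (R : ℝ) ^ 4 / C₁ *
              |kerE (Matrix.specialUnitaryGroup (Fin 2) ℂ) (fundamentalLatticeRep 2) β (fun k => x i k - (R + 1)) (2 * R + 3) U
                (plane (Matrix.specialUnitaryGroup (Fin 2) ℂ) (fundamentalLatticeRep 2) (q i) (x i)) - p (q i) β|)) ≤ Real.exp (B * T.card) := by
  set rF : LatticeRep (Matrix.specialUnitaryGroup (Fin 2) ℂ) := fundamentalLatticeRep 2 with hrF
  -- the linear statistic: the square root of the classical carrier
  set ℓ : ℝ → ℕ → Fin 4 × Fin 4 → (Fin 4 → ℤ) → LGConfig 4 (Matrix.specialUnitaryGroup (Fin 2) ℂ) → ℝ :=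
    fun β R q x η => Real.sqrt (carrierCl rF C s β R q x η) with hℓ
  have hℓm : ∀ β R q x, Measurable (ℓ β R q x) := fun β R q x =>
    (measurable_carrierCl (r := rF) C s β R q x).sqrt
  have hℓb : ∀ β R q x η, |ℓ β R q x η| ≤ Real.sqrt (|β| * (R : ℝ) ^ 4 / |C| * (2 * rF.N)) := fun β R q x η => by
    simp only [hℓ]
    rw [abs_of_nonneg (Real.sqrt_nonneg _)]
    exact Real.sqrt_le_sqrt ((le_abs_self _).trans (abs_carrierCl_le (r := rF) C hs β R q x η))
  -- (split) in the `λ·ℓ²` letters, λ = 1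
  have hsplit' : ∀ β : ℝ, β₁ ≤ β → ∀ R : ℕ, 1 ≤ R → (R : ℝ) * a β ≤ ℓ₁ →
      ∀ (q : Fin 4 × Fin 4) (x : Fin 4 → ℤ), q.1 < q.2 → ∀ η : LGConfig 4 (Matrix.specialUnitaryGroup (Fin 2) ℂ),
        (R : ℝ) ^ 4 / C₁ * |kerE (Matrix.specialUnitaryGroup (Fin 2) ℂ) rF β (fun k => x k - (R + 1)) (2 * R + 3) η
          (plane (Matrix.specialUnitaryGroup (Fin 2) ℂ) rF q x) - p q β| ≤
            A₀ + 1 * (ℓ β R q x η) ^ 2 + LF β R q x η := by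
    intro β hβ R hR hRa q x hq η
    have h0 : 0 ≤ carrierCl rF C s β R q x η := carrierCl_nonneg (r := rF) hC hs (hβ₁.trans hβ) R q x η
    simp only [hℓ]
    rw [one_mul, Real.sq_sqrt h0]
    exact hsplit β hβ R hR hRa q x hq η
  exact responseMomentsOdd6_of_subGaussianLinear_and_polymerLaw hc hle hℓ₁ hC₁ hp ℓ LF
    (fun β R => Real.sqrt (|β| * (R : ℝ) ^ 4 / |C| * (2 * rF.N))) MLF hℓm hℓb hLFm hLFb (m := m) (v := v) (lam := 1)
    zero_le_one (by linarith) hsplit' hEMlin hPL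

end Unit

end Summit.QuantumFields.YangMills.Cruxes.UVSeamRec.TemperedResponse

end
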